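import Summits.HodgeConjecture.HodgeConjecture.Theorems.AnchorTransportVariationalHodgePadicUncountablePropagation

/-!
# Route AnchorTransport — crux `VariationalHodge` (stmt-HodgeConjecture-1076), line `padic-disc-transport`:
# UNCOUNTABLE PROPAGATION (II: any countable field) and STUB G for quasi-projective total spaces

HONEST FRAMING: research route conditional on HC_CM; not a corollary; Q11.4-sentence-2 already refuted in dim ≥ 3.
Helper file on the crux item (nothing here closes it; no definition, no named fact, no `sorry`;
`HC_CM` does not occur). Cell `pub-hodge-ring2`, binder seat `ring2-b03` (gen 32), BINDER-OWNERS row b03.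

Sequel of `AnchorTransportVariationalHodgePadicUncountablePropagation.lean` (uncountable
propagation for an algebraically closed countable field of definition). Here:

* `closure_base_pt_eq_univ_of_factor` — a complex point generic over `k` stays generic over an
  integral extension `k'` (incomparability along the integral projection `S₀ ⊗ k' → S₀`).
* `uncountablePropagation_of_factor`, `uncountablePropagation` — **the hypothesis `hU` of
  `genericPropagation_isQuasiProjective_of_uncountablePropagation`, for EVERY countable `k`**:
  factor `σ : k →+* ℂ` through the algebraic closure `k̄ ↪ ℂ` (`exists_countable_isAlgClosed_factor`),
  identify `f₀ ⊗_σ ℂ ≅ (f₀ ⊗ k̄) ⊗ ℂ` as families (`baseChangeHomObjIsoOfComp_comm`) and move all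
  hypotheses and the conclusion along the isomorphism (`AnchorTransportVariationalHodgePadicDescent`).
* `genericPropagation_of_isQuasiProjectiveOver` — **STUB G (`PadicDiscTransport.GenericPropagation`)
  for QUASI-PROJECTIVE total spaces**: the registered statement with its binders copied verbatim
  plus the one hypothesis `IsQuasiProjectiveOver (𝒳₀ ⊗_σ ℂ)` (the tree's reduction
  `genericPropagation_isQuasiProjective_of_uncountablePropagation` fed with `uncountablePropagation`).

What is NOT here: STUB G for NON-quasi-projective total spaces (proper non-projective `𝒳`).

References: [VoisinHodgeII2003] §3.3.1; [CharlesSchnell2014Notes] Prop. 11.3.11 (proof),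
Lemma 11.3.14; [Voisin2007HodgeLoci] §0; [AtiyahMacdonald1969] Cor. 5.9.
-/

noncomputable section

-- every declaration of this problem lives in `Summit.HodgeConjecture.HodgeConjecture.…` (summit = sub-problem)
set_option linter.dupNamespace false

open CategoryTheory CategoryTheory.Limits AlgebraicGeometry TopologicalSpace
open Literature.AlgebraicGeometry.Motives Literature.AlgebraicGeometry.HodgeTheory

namespace Summit.HodgeConjecture.HodgeConjecture.Theorems

/-! ### Uncountable propagation, any countable field of definition -/

section General

variable {k k' : Type} [Field k] [Field k'] (σ : k →+* ℂ) (σ' : k →+* k') (τ : k' →+* ℂ)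

/-- **A complex point generic over `k` stays generic over an integral extension `k'`**: for
`τ ∘ σ' = σ` with `k'` integral over `σ'(k)`, `S₀` a `k`-scheme whose complexification
`S₀ ⊗_σ ℂ` is irreducible and smooth over `ℂ`, and a complex point `s` of `S₀ ⊗_σ ℂ` over the
generic point of `S₀`, the corresponding complex point `eS⁻¹ s` of `(S₀ ⊗_{σ'} k') ⊗_τ ℂ`
(transitivity of base change) lies over the generic point of `S₀ ⊗_{σ'} k'` (incomparability
along the integral projection `S₀ ⊗ k' → S₀`, Atiyah–Macdonald Cor. 5.9; Charles–Schnell,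
Lemma 11.3.14 for the notion of a generic complex point). [cite: AtiyahMacdonald1969, Cor. 5.9]
[cite: CharlesSchnell2014Notes, Lemma 11.3.14] -/
theorem closure_base_pt_eq_univ_of_factor (hσ' : σ'.IsIntegral) (hτσ : τ.comp σ' = σ)
    (S₀ : SchemeOver k) [IrreducibleSpace ((baseChangeHom σ).obj S₀).left]
    [AlgebraicGeometry.Smooth ((baseChangeHom σ).obj S₀).hom]
    [IrreducibleSpace ((baseChangeHom τ).obj ((baseChangeHom σ').obj S₀)).left]
    [AlgebraicGeometry.Smooth ((baseChangeHom τ).obj ((baseChangeHom σ').obj S₀)).hom]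
    (s : ComplexPoints ((baseChangeHom σ).obj S₀))
    (hs : closure {(baseChangeHomFst σ S₀).base s.pt} = (Set.univ : Set S₀.left)) :
    closure {(baseChangeHomFst τ ((baseChangeHom σ').obj S₀)).base
        (AlgPoints.map (baseChangeHomObjIsoOfComp σ' τ σ hτσ S₀).inv s).pt} =
      (Set.univ : Set ((baseChangeHom σ').obj S₀).left) := by
  haveI : IrreducibleSpace S₀.left := irreducibleSpace_of_baseChangeHom σ S₀
  haveI : IsIntegral ((baseChangeHom σ).obj S₀).left := isIntegral_of_irreducibleSpace_of_smooth _
  haveI : IsIntegral S₀.left := isIntegral_of_baseChangeHom σ S₀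
  haveI : IsIntegral ((baseChangeHom τ).obj ((baseChangeHom σ').obj S₀)).left :=
    isIntegral_of_irreducibleSpace_of_smooth _
  haveI : IsIntegral ((baseChangeHom σ').obj S₀).left :=
    isIntegral_of_baseChangeHom τ ((baseChangeHom σ').obj S₀)
  have e1 : (baseChangeHomObjIsoOfComp σ' τ σ hτσ S₀).inv.left ≫
      baseChangeHomFst τ ((baseChangeHom σ').obj S₀) ≫ baseChangeHomFst σ' S₀ = baseChangeHomFst σ S₀ := by
    rw [← baseChangeHomObjIsoOfComp_hom_left_fst σ' τ σ hτσ S₀, ← Over.comp_left_assoc,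
      Iso.inv_hom_id, Over.id_left, Category.id_comp]
  have e2 := congrArg (fun φ => φ.base s.pt) e1
  simp only [Scheme.Hom.comp_base, TopCat.coe_comp, Function.comp_apply] at e2
  have h1 : baseChangeHomFst σ' S₀ (baseChangeHomFst τ ((baseChangeHom σ').obj S₀)
      (AlgPoints.map (baseChangeHomObjIsoOfComp σ' τ σ hτσ S₀).inv s).pt) = genericPoint S₀.left := by
    rw [AlgPoints.pt_map]
    exact e2.trans (base_pt_eq_genericPoint_of_closure_eq σ S₀ s hs)
  have h2 := eq_genericPoint_of_baseChangeHomFst_eq σ' hσ' S₀ h1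
  change closure {baseChangeHomFst τ ((baseChangeHom σ').obj S₀)
    (AlgPoints.map (baseChangeHomObjIsoOfComp σ' τ σ hτσ S₀).inv s).pt} = Set.univ
  rw [h2]
  exact genericPoint_closure _

/-- **Uncountable propagation along a factorisation `k → k' → ℂ`** with `k'` countable,
algebraically closed and integral over `k`: the statement of `uncountablePropagation` for the
family over `k`, deduced from `uncountablePropagation_of_isAlgClosed` for its base change to `k'`
(the two complexifications are isomorphic families, `baseChangeHomObjIsoOfComp_comm`; all
hypotheses and the conclusion move along the isomorphism). [cite: VoisinHodgeII2003, §3.3.1]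
[cite: CharlesSchnell2014Notes, Prop. 11.3.11 (proof) and Lemma 11.3.14] -/
theorem uncountablePropagation_of_factor [Countable k'] [IsAlgClosed k'] (hσ' : σ'.IsIntegral)
    (hτσ : τ.comp σ' = σ) ⦃n : ℕ⦄ ⦃𝒳₀ S₀ : SchemeOver k⦄ (f₀ : 𝒳₀ ⟶ S₀)
    (hf : IsSmoothProjectiveFamily ((baseChangeHom σ).map f₀) n)
    (hirr : IrreducibleSpace ((baseChangeHom σ).obj S₀).left)
    (haff : IsAffine ((baseChangeHom σ).obj S₀).left)
    (hsm : AlgebraicGeometry.Smooth ((baseChangeHom σ).obj S₀).hom)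
    (hdim : topologicalKrullDim ((baseChangeHom σ).obj S₀).left = 1)
    (h𝒳 : IsQuasiProjectiveOver ((baseChangeHom σ).obj 𝒳₀))
    (p : ℕ) (A : complexBetti ((baseChangeHom σ).obj 𝒳₀) (2 * p))
    (s : ComplexPoints ((baseChangeHom σ).obj S₀))
    (hs : closure {(baseChangeHomFst σ S₀).base s.pt} = (Set.univ : Set S₀.left))
    (hA : complexBetti.map (fiberι ((baseChangeHom σ).map f₀) s) (2 * p) A ∈
      algebraicClasses (fiberOver ((baseChangeHom σ).map f₀) s) p) :
    ¬ {t : ComplexPoints ((baseChangeHom σ).obj S₀) |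
        complexBetti.map (fiberι ((baseChangeHom σ).map f₀) t) (2 * p) A ∈
          algebraicClasses (fiberOver ((baseChangeHom σ).map f₀) t) p}.Countable := by
  classical
  -- ### the isomorphism of complex families `(f₀ ⊗ k') ⊗ ℂ ≅ f₀ ⊗ ℂ`
  have comm : (baseChangeHom τ).map ((baseChangeHom σ').map f₀) ≫
      (baseChangeHomObjIsoOfComp σ' τ σ hτσ S₀).hom =
      (baseChangeHomObjIsoOfComp σ' τ σ hτσ 𝒳₀).hom ≫ (baseChangeHom σ).map f₀ :=
    baseChangeHomObjIsoOfComp_comm σ' τ σ hτσ f₀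
  -- ### transport of the hypotheses
  haveI := hirr
  haveI := haff
  haveI := hsm
  have hf' : IsSmoothProjectiveFamily ((baseChangeHom τ).map ((baseChangeHom σ').map f₀)) n :=
    IsSmoothProjectiveFamily.of_arrowIso _ _ comm hf
  obtain ⟨hirr', haff', hsm', hdim'⟩ :=
    base_hypotheses_of_iso (S' := (baseChangeHom τ).obj ((baseChangeHom σ').obj S₀))
      (baseChangeHomObjIsoOfComp σ' τ σ hτσ S₀) hdim
  have h𝒳' : IsQuasiProjectiveOver ((baseChangeHom τ).obj ((baseChangeHom σ').obj 𝒳₀)) :=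
    isQuasiProjectiveOver_of_iso (baseChangeHomObjIsoOfComp σ' τ σ hτσ 𝒳₀) h𝒳
  have hA' := (map_fiberι_mem_algebraicClasses_iff_of_arrowIso _ _ comm A
      (AlgPoints.map_hom_map_inv_apply (baseChangeHomObjIsoOfComp σ' τ σ hτσ S₀) s)).mpr hA
  haveI := hirr'
  haveI := hsm'
  have hs' := closure_base_pt_eq_univ_of_factor σ σ' τ hσ' hτσ S₀ s hs
  -- ### the algebraically closed case, and transport of the conclusion
  have key := uncountablePropagation_of_isAlgClosed k' τ ((baseChangeHom σ').map f₀) hf' hirr'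
    haff' hsm' hdim' h𝒳' p _ _ hs' hA'
  intro hc
  apply key
  have hinj : Function.Injective
      (AlgPoints.map (baseChangeHomObjIsoOfComp σ' τ σ hτσ S₀).hom :
        ComplexPoints ((baseChangeHom τ).obj ((baseChangeHom σ').obj S₀)) →
          ComplexPoints ((baseChangeHom σ).obj S₀)) :=
    Function.LeftInverse.injective fun P =>
      AlgPoints.map_inv_map_hom_apply (baseChangeHomObjIsoOfComp σ' τ σ hτσ S₀) P
  refine (hc.preimage hinj).mono fun t' ht' => ?_
  exact (map_fiberι_mem_algebraicClasses_iff_of_arrowIso _ _ comm A (s' := t') rfl).1 ht'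

/-- **UNCOUNTABLE PROPAGATION** — the hypothesis `hU` of
`genericPropagation_isQuasiProjective_of_uncountablePropagation`, proved for every countable field
of definition `k`: for `f₀ ⊗_σ ℂ : 𝒳 ⟶ S` a smooth projective family over a smooth irreducible
affine curve with `𝒳` quasi-projective, `A ∈ H²ᵖ(𝒳(ℂ); ℂ)` and a complex point `s` over the
generic point of `S₀` with `A|_{𝒳_s}` algebraic, the set of complex points with algebraic fibre
restriction is not countable (factor `σ` through the algebraic closure of `k` in `ℂ`,
`exists_countable_isAlgClosed_factor`, and apply `uncountablePropagation_of_factor`).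
[cite: VoisinHodgeII2003, §3.3.1] [cite: CharlesSchnell2014Notes, Prop. 11.3.11 (proof) and Lemma 11.3.14] -/
theorem uncountablePropagation (k : Type) [Field k] [Countable k] (σ : k →+* ℂ) ⦃n : ℕ⦄
    ⦃𝒳₀ S₀ : SchemeOver k⦄ (f₀ : 𝒳₀ ⟶ S₀)
    (hf : IsSmoothProjectiveFamily ((baseChangeHom σ).map f₀) n)
    (hirr : IrreducibleSpace ((baseChangeHom σ).obj S₀).left)
    (haff : IsAffine ((baseChangeHom σ).obj S₀).left)
    (hsm : AlgebraicGeometry.Smooth ((baseChangeHom σ).obj S₀).hom)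
    (hdim : topologicalKrullDim ((baseChangeHom σ).obj S₀).left = 1)
    (h𝒳 : IsQuasiProjectiveOver ((baseChangeHom σ).obj 𝒳₀))
    (p : ℕ) (A : complexBetti ((baseChangeHom σ).obj 𝒳₀) (2 * p))
    (s : ComplexPoints ((baseChangeHom σ).obj S₀))
    (hs : closure {(baseChangeHomFst σ S₀).base s.pt} = (Set.univ : Set S₀.left))
    (hA : complexBetti.map (fiberι ((baseChangeHom σ).map f₀) s) (2 * p) A ∈
      algebraicClasses (fiberOver ((baseChangeHom σ).map f₀) s) p) :
    ¬ {t : ComplexPoints ((baseChangeHom σ).obj S₀) |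
        complexBetti.map (fiberι ((baseChangeHom σ).map f₀) t) (2 * p) A ∈
          algebraicClasses (fiberOver ((baseChangeHom σ).map f₀) t) p}.Countable := by
  obtain ⟨k', _, _, _, σ', τ, hσ', hτσ⟩ := exists_countable_isAlgClosed_factor σ
  exact uncountablePropagation_of_factor σ σ' τ hσ' hτσ f₀ hf hirr haff hsm hdim h𝒳 p A s hs hA

end General

/-! ### STUB G for quasi-projective total spaces -/

section StubG

/-- **STUB G (`GenericPropagation`) of line `padic-disc-transport` for QUASI-PROJECTIVE total
spaces, proved**: the registered statement `PadicDiscTransport.GenericPropagation` with its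
binders copied verbatim plus the single hypothesis `IsQuasiProjectiveOver (𝒳₀ ⊗_σ ℂ)` — for a
smooth projective family base-changed from a countable field `k` over a smooth irreducible affine
curve with quasi-projective total space, a global class algebraic on the fibre over ONE `k`-generic
complex point is algebraic on every fibre (`genericPropagation_isQuasiProjective_of_uncountablePropagation`
fed with `uncountablePropagation`). [cite: CharlesSchnell2014Notes, Prop. 11.3.11 and Lemma 11.3.14]
[cite: Voisin2007HodgeLoci, §0 (Introduction), first paragraph] -/
theorem genericPropagation_of_isQuasiProjectiveOver :
    ∀ (k : Type) [Field k] [Countable k] (σ : k →+* ℂ) ⦃n : ℕ⦄ ⦃𝒳₀ S₀ : SchemeOver k⦄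
      (f₀ : 𝒳₀ ⟶ S₀),
      IsSmoothProjectiveFamily ((baseChangeHom σ).map f₀) n →
      IrreducibleSpace ((baseChangeHom σ).obj S₀).left → IsAffine ((baseChangeHom σ).obj S₀).left →
      AlgebraicGeometry.Smooth ((baseChangeHom σ).obj S₀).hom →
      topologicalKrullDim ((baseChangeHom σ).obj S₀).left = 1 →
      IsQuasiProjectiveOver ((baseChangeHom σ).obj 𝒳₀) →
      ∀ (p : ℕ) (A : complexBetti ((baseChangeHom σ).obj 𝒳₀) (2 * p))
        (s : ComplexPoints ((baseChangeHom σ).obj S₀)),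
        (∀ Z : Set (ComplexPoints ((baseChangeHom σ).obj S₀)),
          IsDefinedOver σ S₀ σ.fieldRange Z → s ∈ Z → Z = Set.univ) →
        complexBetti.map (fiberι ((baseChangeHom σ).map f₀) s) (2 * p) A ∈
          algebraicClasses (fiberOver ((baseChangeHom σ).map f₀) s) p →
        ∀ t : ComplexPoints ((baseChangeHom σ).obj S₀),
          complexBetti.map (fiberι ((baseChangeHom σ).map f₀) t) (2 * p) A ∈
            algebraicClasses (fiberOver ((baseChangeHom σ).map f₀) t) p :=
  genericPropagation_isQuasiProjective_of_uncountablePropagation uncountablePropagation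

end StubG

end Summit.HodgeConjecture.HodgeConjecture.Theorems

end
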